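import Mathlib
import Summits.ValiantsHypothesis.ValiantsHypothesis.Theorems.LacunarySymmetroidMatrixDescartesDoorA26WallBubblingMixedParity

/-!
# Wall bubbling for `DoorA26` — obligation (M), the parity law IN THE COLLAPSE REGIME (nested blow-up of the Schur parity sieve)

LINE / STUB.  Crux `Theses.LacunarySymmetroid.DoorA26` (stmt-ValiantsHypothesis-19979; OPEN, typed, never asserted), line
`Cruxes/DoorA26/Lines/wall_bubbling.lean`, obligation **(M) `Stmt.stub_mixedWalls`** (mixed wall `2δᵢ = δₖ + δₗ`).  Companion of
`…WallBubblingMixedParity` (the MIXED-WALL PARITY LAW: `G_jj·B/ρ² → q(ω) = ω₀² − 4ω₁ω₂`, KILL(j) whenever `q(ω) > 0`).  With opposite cross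
signs `q(ω) > 0` fails only in the COLLAPSE REGIME `ω ∈ {±e_k, ±e_l}` (the `j`-cross vector concentrates on one cross entry) — the card's
«degenerate-ratio regimes need a nested blow-up: NOT done».  This file DOES the nested blow-up at the level of exact algebra + limits:

* EXACT EXPANSION (inside the proofs, from `mixedParity_schur_entry`): with `X = B⁻¹ G_II → P`, `γ = G_{I·,j}`, `η = γ/γ_k = (ηᵢ, 1, η_l)`:
  `G_jj · B · det X = γ_k² · (adjX_kk + 2η_l adjX_kl + 2ηᵢ adjX_ik + ηᵢ² adjX_ii + 2ηᵢη_l adjX_il + η_l² adjX_ll)`,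
  where `adjX → adj P = [[−¼,0,0],[0,0,½],[0,½,0]]` (order `(i,k,l)`), `det X → −¼`; the entries that vanish in the limit are
  `adjX_kk = X_ii X_ll − X_il X_li` (the `{i,l}` principal `2 × 2` minor of `G` divided by `B²`), `adjX_ik`, `adjX_il`, `adjX_ll`
  (`adjugate_entries_fin_three`);
* `mixedWall_parity_collapse_k` — **COLLAPSE-REGIME PARITY LAW**: if the cross vector collapses onto `(j,k)` (`ηᵢ, η_l → 0`) with opposite
  cross signs (`η_l < 0`) and the cross ratio DOMINATES the competing second-order terms — `adjX_kk / η_l → 0` (the `{i,l}`-minor of `G` is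
  `o(B² · G_jl/G_jk)`), `ηᵢ·adjX_ik / η_l → 0`, `ηᵢ²/η_l → 0` — then eventually `G_jj · B > 0`: KILL(j) PERSISTS in the collapse regime;
  `mixedWall_parity_collapse_l` is the mirror statement (collapse onto `(j,l)`).
* So at a facet killed by the parity test the residual of (M) is now: accumulation whose `j`-cross vector collapses onto ONE cross entry
  AND whose `{i, other}`-principal minor of `G` is NOT negligible against `B² ×` (cross ratio) — by the sign bookkeeping this needs
  `sgn G_ii = sgn G_ll` (resp. `G_kk`) and a positive (Euclidean) `{i,l}`-minor comparable to the cross ratio; plus W3's anatomy theorem.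

HONEST FRAMING.  Cell `pub-symmetroid`, seat val-sym-door-p2 g11 (re-pointed W1), `--supports stmt-ValiantsHypothesis-19979 --as helper`.
Linear algebra and limits only; no new definitions; a rung of (M): (M), (W), (R) and `DoorA26` stay OPEN; registers unchanged; nothing on
`MatrixDescartes` (stmt-ValiantsHypothesis-18050) or `VP ≠ VNP`. [this work]
-/

-- `Summit.ValiantsHypothesis.ValiantsHypothesis.…` repeats a component by the D-0017 layout
-- (single-conjunct summit), which the `dupNamespace` linter flags; the name is mandated.
set_option linter.dupNamespace false

namespace Summit.ValiantsHypothesis.ValiantsHypothesis.Theorems.LacunarySymmetroidMatrixDescartes.WallBubbling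

open Matrix Finset Filter Topology
open scoped BigOperators

/-- The four adjugate entries of a `3 × 3` matrix used below (order `(i,k,l) = (0,1,2)`): `adj_kk = X_ii X_ll − X_il X_li` (the `{i,l}`
principal minor), `adj_ik = −X_ik X_ll + X_il X_lk`, `adj_ll = X_ii X_kk − X_ik X_ki`, `adj_il = X_ik X_kl − X_il X_kk`. [folklore] -/
theorem adjugate_entries_fin_three (X : Matrix (Fin 3) (Fin 3) ℝ) :
    X.adjugate 1 1 = X 0 0 * X 2 2 - X 0 2 * X 2 0 ∧ X.adjugate 0 1 = -(X 0 1 * X 2 2) + X 0 2 * X 2 1 ∧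
    X.adjugate 2 2 = X 0 0 * X 1 1 - X 0 1 * X 1 0 ∧ X.adjugate 0 2 = X 0 1 * X 1 2 - X 0 2 * X 1 1 := by
  refine ⟨?_, ?_, ?_, ?_⟩ <;> (rw [Matrix.adjugate_fin_three]; simp)

/-- **COLLAPSE-REGIME PARITY LAW, collapse onto `(j,k)`, Schur-hypothesis form.** [this work] -/
theorem mixedWall_parity_collapse_k_of_schur
    (G : ℕ → Matrix (Fin 6) (Fin 6) ℝ)
    (hsymm : ∀ ν a b, G ν a b = G ν b a)
    (I : Fin 3 → Fin 6) (j : Fin 6) (B : ℕ → ℝ) (hB : ∀ ν, B ν ≠ 0)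
    (hschur : ∀ ν, ((G ν).submatrix I I).det ≠ 0 →
      G ν j j * ((G ν).submatrix I I).det = ∑ a, ∑ b, G ν j (I a) * ((G ν).submatrix I I).adjugate a b * G ν (I b) j)
    (hblock : Tendsto (fun ν => (B ν)⁻¹ • (G ν).submatrix I I) atTop
      (𝓝 !![(1 : ℝ), 0, 0; 0, 0, -1/2; 0, -1/2, 0]))
    (hk : ∀ ν, G ν (I 1) j ≠ 0)
    (hopp : ∀ ν, G ν (I 2) j / G ν (I 1) j < 0)
    (hcol_i : Tendsto (fun ν => G ν (I 0) j / G ν (I 1) j) atTop (𝓝 0))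
    (hcol_l : Tendsto (fun ν => G ν (I 2) j / G ν (I 1) j) atTop (𝓝 0))
    (H1 : Tendsto (fun ν => ((B ν)⁻¹ • (G ν).submatrix I I).adjugate 1 1 / (G ν (I 2) j / G ν (I 1) j)) atTop (𝓝 0))
    (H2 : Tendsto (fun ν => (G ν (I 0) j / G ν (I 1) j) * ((B ν)⁻¹ • (G ν).submatrix I I).adjugate 0 1 /
      (G ν (I 2) j / G ν (I 1) j)) atTop (𝓝 0))
    (H3 : Tendsto (fun ν => (G ν (I 0) j / G ν (I 1) j) ^ 2 / (G ν (I 2) j / G ν (I 1) j)) atTop (𝓝 0)) :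
    ∀ᶠ ν in atTop, 0 < G ν j j * B ν := by
  set P : Matrix (Fin 3) (Fin 3) ℝ := !![(1 : ℝ), 0, 0; 0, 0, -1/2; 0, -1/2, 0] with hP
  set X : ℕ → Matrix (Fin 3) (Fin 3) ℝ := fun ν => (B ν)⁻¹ • (G ν).submatrix I I with hX
  set ηi : ℕ → ℝ := fun ν => G ν (I 0) j / G ν (I 1) j with hηi
  set ηl : ℕ → ℝ := fun ν => G ν (I 2) j / G ν (I 1) j with hηl
  have hGX : ∀ ν, (G ν).submatrix I I = B ν • X ν := by
    intro ν; simp only [hX, smul_smul, mul_inv_cancel₀ (hB ν), one_smul]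
  have hdetP : P.det = -1/4 := by
    simp [hP, Matrix.det_fin_three]; norm_num
  have hadjP : P.adjugate = !![(-1/4 : ℝ), 0, 0; 0, 0, 1/2; 0, 1/2, 0] := by
    rw [hP, Matrix.adjugate_fin_three_of]
    ext a b; fin_cases a <;> fin_cases b <;> simp <;> norm_num
  have hdetX : Tendsto (fun ν => (X ν).det) atTop (𝓝 P.det) :=
    ((continuous_id.matrix_det).tendsto P).comp hblock
  have hadjX : Tendsto (fun ν => (X ν).adjugate) atTop (𝓝 P.adjugate) :=
    ((continuous_id.matrix_adjugate).tendsto P).comp hblock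
  have hadj_ab : ∀ a b, Tendsto (fun ν => (X ν).adjugate a b) atTop (𝓝 (P.adjugate a b)) := fun a b =>
    tendsto_pi_nhds.1 (tendsto_pi_nhds.1 hadjX a) b
  have hdetne : ∀ᶠ ν in atTop, (X ν).det ≠ 0 := hdetX.eventually_ne (by rw [hdetP]; norm_num)
  have hdetneg : ∀ᶠ ν in atTop, (X ν).det < 0 := hdetX.eventually (eventually_lt_nhds (by rw [hdetP]; norm_num))
  -- the normalised quadratic form Q ν = ∑ η_a adjX_ab η_b with η = (ηi, 1, ηl)
  have hηl_ne : ∀ ν, ηl ν ≠ 0 := fun ν => (hopp ν).ne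
  -- exact identity: G_jj * B * det X = (G (I 1) j)^2 * Q
  have hid : ∀ᶠ ν in atTop, G ν j j * B ν * (X ν).det =
      G ν (I 1) j ^ 2 * ((X ν).adjugate 1 1 + 2 * ηl ν * (X ν).adjugate 1 2 + 2 * ηi ν * (X ν).adjugate 0 1
        + ηi ν ^ 2 * (X ν).adjugate 0 0 + 2 * ηi ν * ηl ν * (X ν).adjugate 0 2 + ηl ν ^ 2 * (X ν).adjugate 2 2) := by
    filter_upwards [hdetne] with ν hν
    have hdetG : ((G ν).submatrix I I).det = B ν ^ 3 * (X ν).det := by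
      rw [hGX ν, Matrix.det_smul]; simp
    have hadjG : ((G ν).submatrix I I).adjugate = B ν ^ 2 • (X ν).adjugate := by
      rw [hGX ν, Matrix.adjugate_smul]; simp
    have hI : ((G ν).submatrix I I).det ≠ 0 := by
      rw [hdetG]; exact mul_ne_zero (pow_ne_zero _ (hB ν)) hν
    have hs := hschur ν hI
    rw [hdetG, hadjG] at hs
    simp only [Matrix.smul_apply, smul_eq_mul] at hs
    -- adjugate of the symmetric X is symmetric in the entries we use: derive from symmetry of G
    have hXs : ∀ a b, X ν a b = X ν b a := by
      intro a b; simp only [hX, Matrix.smul_apply, Matrix.submatrix_apply, smul_eq_mul, hsymm ν (I a) (I b)]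
    have hXsymm : (X ν)ᵀ = X ν := by ext a b; exact hXs b a
    have hadjs : ∀ a b, (X ν).adjugate a b = (X ν).adjugate b a := by
      intro a b
      have := congrFun (congrFun (Matrix.adjugate_transpose (X ν)) a) b
      rw [hXsymm] at this
      simpa [Matrix.transpose_apply] using this.symm
    have hk' := hk ν
    have hB' := hB ν
    -- expand the double sum over Fin 3
    simp only [Fin.sum_univ_three] at hs
    rw [hsymm ν j (I 0), hsymm ν j (I 1), hsymm ν j (I 2)] at hs
    simp only [hηi, hηl]
    rw [hadjs 1 0, hadjs 2 0, hadjs 2 1] at hs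
    field_simp
    apply mul_left_cancel₀ (pow_ne_zero 2 hB')
    linear_combination hs
  -- the normalised form Q/ηl → 1
  have h12 : Tendsto (fun ν => (X ν).adjugate 1 2) atTop (𝓝 (1/2)) := by
    have := hadj_ab 1 2; rw [hadjP] at this; simpa using this
  have h00 : Tendsto (fun ν => (X ν).adjugate 0 0) atTop (𝓝 (-1/4)) := by
    have := hadj_ab 0 0; rw [hadjP] at this; simpa using this
  have h02 : Tendsto (fun ν => (X ν).adjugate 0 2) atTop (𝓝 0) := by
    have := hadj_ab 0 2; rw [hadjP] at this; simpa using this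
  have h22 : Tendsto (fun ν => (X ν).adjugate 2 2) atTop (𝓝 0) := by
    have := hadj_ab 2 2; rw [hadjP] at this; simpa using this
  have hQ : Tendsto (fun ν => (X ν).adjugate 1 1 / ηl ν + 2 * (X ν).adjugate 1 2 + 2 * (ηi ν * (X ν).adjugate 0 1 / ηl ν)
      + (ηi ν ^ 2 / ηl ν) * (X ν).adjugate 0 0 + 2 * ηi ν * (X ν).adjugate 0 2 + ηl ν * (X ν).adjugate 2 2)
      atTop (𝓝 (0 + 2 * (1/2) + 2 * 0 + 0 * (-1/4) + 2 * 0 * 0 + 0 * 0)) := by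
    refine ((((H1.add (h12.const_mul 2)).add (H2.const_mul 2)).add (H3.mul h00)).add
      ((hcol_i.const_mul 2).mul h02)).add (hcol_l.mul h22)
  have hQ1 : Tendsto (fun ν => (X ν).adjugate 1 1 / ηl ν + 2 * (X ν).adjugate 1 2 + 2 * (ηi ν * (X ν).adjugate 0 1 / ηl ν)
      + (ηi ν ^ 2 / ηl ν) * (X ν).adjugate 0 0 + 2 * ηi ν * (X ν).adjugate 0 2 + ηl ν * (X ν).adjugate 2 2)
      atTop (𝓝 1) := by
    convert hQ using 2; norm_num
  have hQpos := hQ1.eventually (eventually_gt_nhds zero_lt_one)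
  filter_upwards [hid, hQpos, hdetneg] with ν hν hq hdet
  -- G_jj B det X = γ_k² ηl · (Q/ηl) with γ_k² > 0, ηl < 0, Q/ηl > 0, det X < 0
  have hηl' : ηl ν < 0 := hopp ν
  have hγ2 : 0 < G ν (I 1) j ^ 2 := by have h := hk ν; positivity
  have hfac : G ν j j * B ν * (X ν).det = G ν (I 1) j ^ 2 * ηl ν *
      ((X ν).adjugate 1 1 / ηl ν + 2 * (X ν).adjugate 1 2 + 2 * (ηi ν * (X ν).adjugate 0 1 / ηl ν)
      + (ηi ν ^ 2 / ηl ν) * (X ν).adjugate 0 0 + 2 * ηi ν * (X ν).adjugate 0 2 + ηl ν * (X ν).adjugate 2 2) := by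
    rw [hν]
    have hne := hηl_ne ν
    field_simp
  have hneg : G ν j j * B ν * (X ν).det < 0 := by
    rw [hfac]
    have : G ν (I 1) j ^ 2 * ηl ν < 0 := mul_neg_of_pos_of_neg hγ2 hηl'
    exact mul_neg_of_neg_of_pos this hq
  by_contra hcon
  have hle : G ν j j * B ν ≤ 0 := not_lt.mp hcon
  have : 0 ≤ G ν j j * B ν * (X ν).det := mul_nonneg_of_nonpos_of_nonpos hle hdet.le
  linarith


/-- **COLLAPSE-REGIME PARITY LAW (collapse onto `(j,k)`)** for realisable-shaped sequences: `I`-block blowing up to the mixed pattern,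
`j`-cross vector collapsing onto the entry `(j,k)` with the opposite-sign entry `(j,l)` dominating the `{i,l}`-minor, the `(i,k)`-cofactor
cross term and `ηᵢ²` ⇒ eventually `G_jj · B > 0` (KILL(j) persists). [this work] -/
theorem mixedWall_parity_collapse_k
    (G : ℕ → Matrix (Fin 6) (Fin 6) ℝ)
    (hshape : ∀ ν, ∃ (ε : ℝ) (v u w : Fin 6 → ℝ), G ν = ε • (vecMulVec v v - vecMulVec u u - vecMulVec w w))
    (I : Fin 3 → Fin 6) (j : Fin 6) (B : ℕ → ℝ) (hB : ∀ ν, B ν ≠ 0)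
    (hblock : Tendsto (fun ν => (B ν)⁻¹ • (G ν).submatrix I I) atTop
      (𝓝 !![(1 : ℝ), 0, 0; 0, 0, -1/2; 0, -1/2, 0]))
    (hk : ∀ ν, G ν (I 1) j ≠ 0)
    (hopp : ∀ ν, G ν (I 2) j / G ν (I 1) j < 0)
    (hcol_i : Tendsto (fun ν => G ν (I 0) j / G ν (I 1) j) atTop (𝓝 0))
    (hcol_l : Tendsto (fun ν => G ν (I 2) j / G ν (I 1) j) atTop (𝓝 0))
    (H1 : Tendsto (fun ν => ((B ν)⁻¹ • (G ν).submatrix I I).adjugate 1 1 / (G ν (I 2) j / G ν (I 1) j)) atTop (𝓝 0))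
    (H2 : Tendsto (fun ν => (G ν (I 0) j / G ν (I 1) j) * ((B ν)⁻¹ • (G ν).submatrix I I).adjugate 0 1 /
      (G ν (I 2) j / G ν (I 1) j)) atTop (𝓝 0))
    (H3 : Tendsto (fun ν => (G ν (I 0) j / G ν (I 1) j) ^ 2 / (G ν (I 2) j / G ν (I 1) j)) atTop (𝓝 0)) :
    ∀ᶠ ν in atTop, 0 < G ν j j * B ν := by
  refine mixedWall_parity_collapse_k_of_schur G (fun ν a b => ?_) I j B hB (fun ν hI => ?_) hblock hk hopp hcol_i hcol_l H1 H2 H3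
  · obtain ⟨ε, v, u, w, h⟩ := hshape ν
    exact shape_symm ε v u w (G ν) h a b
  · obtain ⟨ε, v, u, w, h⟩ := hshape ν
    exact mixedParity_schur_entry ε v u w (G ν) h I j hI

/-- **COLLAPSE-REGIME PARITY LAW, collapse onto `(j,l)`, Schur-hypothesis form** (mirror of the `(j,k)` statement under `k ↔ l`). [this work] -/
theorem mixedWall_parity_collapse_l_of_schur
    (G : ℕ → Matrix (Fin 6) (Fin 6) ℝ)
    (hsymm : ∀ ν a b, G ν a b = G ν b a)
    (I : Fin 3 → Fin 6) (j : Fin 6) (B : ℕ → ℝ) (hB : ∀ ν, B ν ≠ 0)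
    (hschur : ∀ ν, ((G ν).submatrix I I).det ≠ 0 →
      G ν j j * ((G ν).submatrix I I).det = ∑ a, ∑ b, G ν j (I a) * ((G ν).submatrix I I).adjugate a b * G ν (I b) j)
    (hblock : Tendsto (fun ν => (B ν)⁻¹ • (G ν).submatrix I I) atTop
      (𝓝 !![(1 : ℝ), 0, 0; 0, 0, -1/2; 0, -1/2, 0]))
    (hl : ∀ ν, G ν (I 2) j ≠ 0)
    (hopp : ∀ ν, G ν (I 1) j / G ν (I 2) j < 0)
    (hcol_i : Tendsto (fun ν => G ν (I 0) j / G ν (I 2) j) atTop (𝓝 0))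
    (hcol_k : Tendsto (fun ν => G ν (I 1) j / G ν (I 2) j) atTop (𝓝 0))
    (H1 : Tendsto (fun ν => ((B ν)⁻¹ • (G ν).submatrix I I).adjugate 2 2 / (G ν (I 1) j / G ν (I 2) j)) atTop (𝓝 0))
    (H2 : Tendsto (fun ν => (G ν (I 0) j / G ν (I 2) j) * ((B ν)⁻¹ • (G ν).submatrix I I).adjugate 0 2 /
      (G ν (I 1) j / G ν (I 2) j)) atTop (𝓝 0))
    (H3 : Tendsto (fun ν => (G ν (I 0) j / G ν (I 2) j) ^ 2 / (G ν (I 1) j / G ν (I 2) j)) atTop (𝓝 0)) :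
    ∀ᶠ ν in atTop, 0 < G ν j j * B ν := by
  set P : Matrix (Fin 3) (Fin 3) ℝ := !![(1 : ℝ), 0, 0; 0, 0, -1/2; 0, -1/2, 0] with hP
  set X : ℕ → Matrix (Fin 3) (Fin 3) ℝ := fun ν => (B ν)⁻¹ • (G ν).submatrix I I with hX
  set ηi : ℕ → ℝ := fun ν => G ν (I 0) j / G ν (I 2) j with hηi
  set ηk : ℕ → ℝ := fun ν => G ν (I 1) j / G ν (I 2) j with hηk
  have hGX : ∀ ν, (G ν).submatrix I I = B ν • X ν := by
    intro ν; simp only [hX, smul_smul, mul_inv_cancel₀ (hB ν), one_smul]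
  have hdetP : P.det = -1/4 := by
    simp [hP, Matrix.det_fin_three]; norm_num
  have hadjP : P.adjugate = !![(-1/4 : ℝ), 0, 0; 0, 0, 1/2; 0, 1/2, 0] := by
    rw [hP, Matrix.adjugate_fin_three_of]
    ext a b; fin_cases a <;> fin_cases b <;> simp <;> norm_num
  have hdetX : Tendsto (fun ν => (X ν).det) atTop (𝓝 P.det) :=
    ((continuous_id.matrix_det).tendsto P).comp hblock
  have hadjX : Tendsto (fun ν => (X ν).adjugate) atTop (𝓝 P.adjugate) :=
    ((continuous_id.matrix_adjugate).tendsto P).comp hblock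
  have hadj_ab : ∀ a b, Tendsto (fun ν => (X ν).adjugate a b) atTop (𝓝 (P.adjugate a b)) := fun a b =>
    tendsto_pi_nhds.1 (tendsto_pi_nhds.1 hadjX a) b
  have hdetne : ∀ᶠ ν in atTop, (X ν).det ≠ 0 := hdetX.eventually_ne (by rw [hdetP]; norm_num)
  have hdetneg : ∀ᶠ ν in atTop, (X ν).det < 0 := hdetX.eventually (eventually_lt_nhds (by rw [hdetP]; norm_num))
  -- the normalised quadratic form Q ν = ∑ η_a adjX_ab η_b with η = (ηi, 1, ηk)
  have hηk_ne : ∀ ν, ηk ν ≠ 0 := fun ν => (hopp ν).ne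
  -- exact identity: G_jj * B * det X = (G (I 2) j)^2 * Q
  have hid : ∀ᶠ ν in atTop, G ν j j * B ν * (X ν).det =
      G ν (I 2) j ^ 2 * ((X ν).adjugate 2 2 + 2 * ηk ν * (X ν).adjugate 1 2 + 2 * ηi ν * (X ν).adjugate 0 2
        + ηi ν ^ 2 * (X ν).adjugate 0 0 + 2 * ηi ν * ηk ν * (X ν).adjugate 0 1 + ηk ν ^ 2 * (X ν).adjugate 1 1) := by
    filter_upwards [hdetne] with ν hν
    have hdetG : ((G ν).submatrix I I).det = B ν ^ 3 * (X ν).det := by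
      rw [hGX ν, Matrix.det_smul]; simp
    have hadjG : ((G ν).submatrix I I).adjugate = B ν ^ 2 • (X ν).adjugate := by
      rw [hGX ν, Matrix.adjugate_smul]; simp
    have hI : ((G ν).submatrix I I).det ≠ 0 := by
      rw [hdetG]; exact mul_ne_zero (pow_ne_zero _ (hB ν)) hν
    have hs := hschur ν hI
    rw [hdetG, hadjG] at hs
    simp only [Matrix.smul_apply, smul_eq_mul] at hs
    -- adjugate of the symmetric X is symmetric in the entries we use: derive from symmetry of G
    have hXs : ∀ a b, X ν a b = X ν b a := by
      intro a b; simp only [hX, Matrix.smul_apply, Matrix.submatrix_apply, smul_eq_mul, hsymm ν (I a) (I b)]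
    have hXsymm : (X ν)ᵀ = X ν := by ext a b; exact hXs b a
    have hadjs : ∀ a b, (X ν).adjugate a b = (X ν).adjugate b a := by
      intro a b
      have := congrFun (congrFun (Matrix.adjugate_transpose (X ν)) a) b
      rw [hXsymm] at this
      simpa [Matrix.transpose_apply] using this.symm
    have hk' := hl ν
    have hB' := hB ν
    -- expand the double sum over Fin 3
    simp only [Fin.sum_univ_three] at hs
    rw [hsymm ν j (I 0), hsymm ν j (I 2), hsymm ν j (I 1)] at hs
    simp only [hηi, hηk]
    rw [hadjs 1 0, hadjs 2 0, hadjs 2 1] at hs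
    field_simp
    apply mul_left_cancel₀ (pow_ne_zero 2 hB')
    linear_combination hs
  -- the normalised form Q/ηk → 1
  have h12 : Tendsto (fun ν => (X ν).adjugate 1 2) atTop (𝓝 (1/2)) := by
    have := hadj_ab 1 2; rw [hadjP] at this; simpa using this
  have h00 : Tendsto (fun ν => (X ν).adjugate 0 0) atTop (𝓝 (-1/4)) := by
    have := hadj_ab 0 0; rw [hadjP] at this; simpa using this
  have h02 : Tendsto (fun ν => (X ν).adjugate 0 1) atTop (𝓝 0) := by
    have := hadj_ab 0 1; rw [hadjP] at this; simpa using this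
  have h22 : Tendsto (fun ν => (X ν).adjugate 1 1) atTop (𝓝 0) := by
    have := hadj_ab 1 1; rw [hadjP] at this; simpa using this
  have hQ : Tendsto (fun ν => (X ν).adjugate 2 2 / ηk ν + 2 * (X ν).adjugate 1 2 + 2 * (ηi ν * (X ν).adjugate 0 2 / ηk ν)
      + (ηi ν ^ 2 / ηk ν) * (X ν).adjugate 0 0 + 2 * ηi ν * (X ν).adjugate 0 1 + ηk ν * (X ν).adjugate 1 1)
      atTop (𝓝 (0 + 2 * (1/2) + 2 * 0 + 0 * (-1/4) + 2 * 0 * 0 + 0 * 0)) := by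
    refine ((((H1.add (h12.const_mul 2)).add (H2.const_mul 2)).add (H3.mul h00)).add
      ((hcol_i.const_mul 2).mul h02)).add (hcol_k.mul h22)
  have hQ1 : Tendsto (fun ν => (X ν).adjugate 2 2 / ηk ν + 2 * (X ν).adjugate 1 2 + 2 * (ηi ν * (X ν).adjugate 0 2 / ηk ν)
      + (ηi ν ^ 2 / ηk ν) * (X ν).adjugate 0 0 + 2 * ηi ν * (X ν).adjugate 0 1 + ηk ν * (X ν).adjugate 1 1)
      atTop (𝓝 1) := by
    convert hQ using 2; norm_num
  have hQpos := hQ1.eventually (eventually_gt_nhds zero_lt_one)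
  filter_upwards [hid, hQpos, hdetneg] with ν hν hq hdet
  -- G_jj B det X = γ_k² ηk · (Q/ηk) with γ_k² > 0, ηk < 0, Q/ηk > 0, det X < 0
  have hηk' : ηk ν < 0 := hopp ν
  have hγ2 : 0 < G ν (I 2) j ^ 2 := by have h := hl ν; positivity
  have hfac : G ν j j * B ν * (X ν).det = G ν (I 2) j ^ 2 * ηk ν *
      ((X ν).adjugate 2 2 / ηk ν + 2 * (X ν).adjugate 1 2 + 2 * (ηi ν * (X ν).adjugate 0 2 / ηk ν)
      + (ηi ν ^ 2 / ηk ν) * (X ν).adjugate 0 0 + 2 * ηi ν * (X ν).adjugate 0 1 + ηk ν * (X ν).adjugate 1 1) := by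
    rw [hν]
    have hne := hηk_ne ν
    field_simp
  have hneg : G ν j j * B ν * (X ν).det < 0 := by
    rw [hfac]
    have : G ν (I 2) j ^ 2 * ηk ν < 0 := mul_neg_of_pos_of_neg hγ2 hηk'
    exact mul_neg_of_neg_of_pos this hq
  by_contra hcon
  have hle : G ν j j * B ν ≤ 0 := not_lt.mp hcon
  have : 0 ≤ G ν j j * B ν * (X ν).det := mul_nonneg_of_nonpos_of_nonpos hle hdet.le
  linarith


/-- **COLLAPSE-REGIME PARITY LAW (collapse onto `(j,l)`)** for realisable-shaped sequences (mirror statement). [this work] -/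
theorem mixedWall_parity_collapse_l
    (G : ℕ → Matrix (Fin 6) (Fin 6) ℝ)
    (hshape : ∀ ν, ∃ (ε : ℝ) (v u w : Fin 6 → ℝ), G ν = ε • (vecMulVec v v - vecMulVec u u - vecMulVec w w))
    (I : Fin 3 → Fin 6) (j : Fin 6) (B : ℕ → ℝ) (hB : ∀ ν, B ν ≠ 0)
    (hblock : Tendsto (fun ν => (B ν)⁻¹ • (G ν).submatrix I I) atTop
      (𝓝 !![(1 : ℝ), 0, 0; 0, 0, -1/2; 0, -1/2, 0]))
    (hl : ∀ ν, G ν (I 2) j ≠ 0)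
    (hopp : ∀ ν, G ν (I 1) j / G ν (I 2) j < 0)
    (hcol_i : Tendsto (fun ν => G ν (I 0) j / G ν (I 2) j) atTop (𝓝 0))
    (hcol_k : Tendsto (fun ν => G ν (I 1) j / G ν (I 2) j) atTop (𝓝 0))
    (H1 : Tendsto (fun ν => ((B ν)⁻¹ • (G ν).submatrix I I).adjugate 2 2 / (G ν (I 1) j / G ν (I 2) j)) atTop (𝓝 0))
    (H2 : Tendsto (fun ν => (G ν (I 0) j / G ν (I 2) j) * ((B ν)⁻¹ • (G ν).submatrix I I).adjugate 0 2 /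
      (G ν (I 1) j / G ν (I 2) j)) atTop (𝓝 0))
    (H3 : Tendsto (fun ν => (G ν (I 0) j / G ν (I 2) j) ^ 2 / (G ν (I 1) j / G ν (I 2) j)) atTop (𝓝 0)) :
    ∀ᶠ ν in atTop, 0 < G ν j j * B ν := by
  refine mixedWall_parity_collapse_l_of_schur G (fun ν a b => ?_) I j B hB (fun ν hI => ?_) hblock hl hopp hcol_i hcol_k H1 H2 H3
  · obtain ⟨ε, v, u, w, h⟩ := hshape ν
    exact shape_symm ε v u w (G ν) h a b
  · obtain ⟨ε, v, u, w, h⟩ := hshape ν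
    exact mixedParity_schur_entry ε v u w (G ν) h I j hI

end Summit.ValiantsHypothesis.ValiantsHypothesis.Theorems.LacunarySymmetroidMatrixDescartes.WallBubbling
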